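import Summits.Parity.GeneralizedHardyLittlewood.Theorems.GreenTaoLevelTwoMNTwoRotationBohrSize

/-!
# Route `GreenTaoLevelTwo`, crux `MNTwo` (stmt-Parity-21276), line `birth`, stub `stub_mnVertical`:
# the rotation Bohr gauge `‖n‖_g = maxᵢ ‖nαᵢ‖ + |n|/N` (GT 2008b Def. 13) as an abstract gauge

Glue for blocks V4–V6 of the `stub_mnVertical` census (B. Green, T. Tao, *Quadratic uniformity of
the Möbius function*, Ann. Inst. Fourier 58 (2008) = arXiv:math/0606087, §6 Definition 13: "we define
the “norm” `‖n‖_g := ‖gⁿ‖_{G/Γ} + |n/N|` … We observe the sub-homogeneity property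
`‖nm‖_g ≤ |n|‖m‖_g`").  The §9/§12 files `…MNTwoLocalQuadratic`, `…MNTwoMajorArcThreeTerm`,
`…MNTwoMajorArcLocal` are written for an ABSTRACT gauge `ν : ℤ → ℝ` (`ν 0 = 0`, `ν ≥ 0`,
subadditive); the blocks V1/V2 and Lemma 14 (`…MNTwoRotationBohr{Size,Doubling,Divisible}`) use the
Bohr PREDICATE `(∀ i, ‖nαᵢ‖ + |n|/N < ρ) ∧ |n|/N < ρ` for a rotation `α ∈ ℝᵏ`.  This def-free file
identifies the two: the explicit gauge `ν(n) = (⨆ᵢ ‖nαᵢ‖_{ℝ/ℤ}) + |n|/N` (for `k = 0` the supremum is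
`0`) satisfies the gauge axioms, its strict sublevel sets are exactly the Bohr predicate, it
dominates `|n|/N`, and the shift set `H = q·B_α(0,η)` needed in §12 has `#H ≥ (η/16)^{k+1}N/2`
(Lemma 14 (a)) and elements `h = qa`, `ν(a) < η`, `|h| ≤ qηN`.

* `bohrGauge_nonneg`, `bohrGauge_zero`, `bohrGauge_neg`, `bohrGauge_add_le` — gauge axioms;
* `bohrGauge_lt_iff` — `ν n < ρ ↔ ((∀ i, ‖nαᵢ‖ + |n|/N < ρ) ∧ |n|/N < ρ)`;
* `abs_le_mul_bohrGauge` — `|n| ≤ N ν(n)`;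
* `shiftSet_spec` — the shift set `H = q·B_α(0,η)`: size, membership of `0`, structure and size
  of its elements.

References: [GreenTao2008QuadraticMobius] arXiv:math/0606087 §6 Def. 13, Lemma 14 (a); §12.
-/

noncomputable section

open Finset Real

namespace Summit.Parity.GeneralizedHardyLittlewood.GreenTaoLevelTwoMNTwoBohrGauge

open Summit.Parity.GeneralizedHardyLittlewood.GreenTaoLevelTwoMNTwoRotationBohrSize
  (card_rotationBohr_ge)

variable {k : ℕ}

/-- The torus part of the gauge is bounded above (finite index), so `le_ciSup` applies. [folklore] -/
theorem bddAbove_range_norm (α : Fin k → ℝ) (n : ℤ) :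
    BddAbove (Set.range fun i : Fin k => ‖(((n : ℝ) * α i : ℝ) : AddCircle (1 : ℝ))‖) :=
  (Set.finite_range _).bddAbove

/-- `0 ≤ ⨆ᵢ ‖nαᵢ‖`. [folklore] -/
theorem iSup_norm_nonneg (α : Fin k → ℝ) (n : ℤ) :
    0 ≤ ⨆ i : Fin k, ‖(((n : ℝ) * α i : ℝ) : AddCircle (1 : ℝ))‖ :=
  Real.iSup_nonneg fun _ => norm_nonneg _

/-- The gauge is nonnegative. [folklore] -/
theorem bohrGauge_nonneg (α : Fin k → ℝ) (N : ℕ) (n : ℤ) :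
    0 ≤ (⨆ i : Fin k, ‖(((n : ℝ) * α i : ℝ) : AddCircle (1 : ℝ))‖) + |(n : ℝ)| / N := by
  have := iSup_norm_nonneg α n; positivity

/-- The gauge vanishes at `0`. [folklore] -/
theorem bohrGauge_zero (α : Fin k → ℝ) (N : ℕ) :
    (⨆ i : Fin k, ‖((((0 : ℤ) : ℝ) * α i : ℝ) : AddCircle (1 : ℝ))‖) + |((0 : ℤ) : ℝ)| / N = 0 := by
  have h1 : (⨆ i : Fin k, ‖((((0 : ℤ) : ℝ) * α i : ℝ) : AddCircle (1 : ℝ))‖) = 0 := by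
    apply le_antisymm _ (iSup_norm_nonneg α 0)
    exact Real.iSup_le (fun i => by simp) le_rfl
  rw [h1]; simp

/-- The gauge is symmetric. [folklore] -/
theorem bohrGauge_neg (α : Fin k → ℝ) (N : ℕ) (n : ℤ) :
    (⨆ i : Fin k, ‖((((-n : ℤ) : ℝ) * α i : ℝ) : AddCircle (1 : ℝ))‖) + |((-n : ℤ) : ℝ)| / N =
      (⨆ i : Fin k, ‖(((n : ℝ) * α i : ℝ) : AddCircle (1 : ℝ))‖) + |(n : ℝ)| / N := by
  have h : ∀ i : Fin k, ‖((((-n : ℤ) : ℝ) * α i : ℝ) : AddCircle (1 : ℝ))‖ =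
      ‖(((n : ℝ) * α i : ℝ) : AddCircle (1 : ℝ))‖ := by
    intro i
    rw [show (((-n : ℤ) : ℝ) * α i : ℝ) = -((n : ℝ) * α i) by push_cast; ring, AddCircle.coe_neg,
      norm_neg]
  simp_rw [h]
  push_cast
  rw [abs_neg]

/-- The gauge is subadditive. [folklore] -/
theorem bohrGauge_add_le (α : Fin k → ℝ) (N : ℕ) (x y : ℤ) :
    (⨆ i : Fin k, ‖((((x + y : ℤ) : ℝ) * α i : ℝ) : AddCircle (1 : ℝ))‖) + |((x + y : ℤ) : ℝ)| / N ≤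
      ((⨆ i : Fin k, ‖(((x : ℝ) * α i : ℝ) : AddCircle (1 : ℝ))‖) + |(x : ℝ)| / N) +
        ((⨆ i : Fin k, ‖(((y : ℝ) * α i : ℝ) : AddCircle (1 : ℝ))‖) + |(y : ℝ)| / N) := by
  have h1 : (⨆ i : Fin k, ‖((((x + y : ℤ) : ℝ) * α i : ℝ) : AddCircle (1 : ℝ))‖) ≤
      (⨆ i : Fin k, ‖(((x : ℝ) * α i : ℝ) : AddCircle (1 : ℝ))‖) +
        (⨆ i : Fin k, ‖(((y : ℝ) * α i : ℝ) : AddCircle (1 : ℝ))‖) := by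
    refine Real.iSup_le (fun i => ?_) (add_nonneg (iSup_norm_nonneg α x) (iSup_norm_nonneg α y))
    have e : ((((x + y : ℤ) : ℝ) * α i : ℝ) : AddCircle (1 : ℝ)) =
        (((x : ℝ) * α i : ℝ) : AddCircle (1 : ℝ)) + (((y : ℝ) * α i : ℝ) : AddCircle (1 : ℝ)) := by
      rw [← AddCircle.coe_add]; push_cast; ring_nf
    rw [e]
    exact (norm_add_le _ _).trans (add_le_add (le_ciSup (bddAbove_range_norm α x) i)
      (le_ciSup (bddAbove_range_norm α y) i))
  have h2 : |((x + y : ℤ) : ℝ)| / N ≤ |(x : ℝ)| / N + |(y : ℝ)| / N := by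
    rw [← add_div]
    apply div_le_div_of_nonneg_right _ (Nat.cast_nonneg _)
    push_cast; exact abs_add_le _ _
  linarith

/-- **Strict sublevel sets of the gauge are the Bohr predicate** of `…MNTwoRotationBohrSize`:
`ν(n) < ρ ↔ (∀ i, ‖nαᵢ‖ + |n|/N < ρ) ∧ |n|/N < ρ`. [cite: GreenTao2008QuadraticMobius, Def. 13] -/
theorem bohrGauge_lt_iff (α : Fin k → ℝ) (N : ℕ) (n : ℤ) (ρ : ℝ) :
    (⨆ i : Fin k, ‖(((n : ℝ) * α i : ℝ) : AddCircle (1 : ℝ))‖) + |(n : ℝ)| / N < ρ ↔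
      ((∀ i, ‖(((n : ℝ) * α i : ℝ) : AddCircle (1 : ℝ))‖ + |(n : ℝ)| / N < ρ) ∧ |(n : ℝ)| / N < ρ) := by
  constructor
  · intro h
    refine ⟨fun i => lt_of_le_of_lt ?_ h, lt_of_le_of_lt ?_ h⟩
    · exact add_le_add (le_ciSup (bddAbove_range_norm α n) i) le_rfl
    · have := iSup_norm_nonneg α n; linarith
  · rintro ⟨hall, habs⟩
    rcases isEmpty_or_nonempty (Fin k) with hk | hk
    · rw [Real.iSup_of_isEmpty, zero_add]; exact habs
    · obtain ⟨i, hi⟩ := exists_eq_ciSup_of_finite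
        (f := fun i : Fin k => ‖(((n : ℝ) * α i : ℝ) : AddCircle (1 : ℝ))‖)
      rw [← hi]; exact hall i

/-- The gauge dominates `|n|/N`: `|n| ≤ N ν(n)`. [folklore] -/
theorem abs_le_mul_bohrGauge (α : Fin k → ℝ) {N : ℕ} (hN : 1 ≤ N) (n : ℤ) :
    |(n : ℝ)| ≤ N * ((⨆ i : Fin k, ‖(((n : ℝ) * α i : ℝ) : AddCircle (1 : ℝ))‖) + |(n : ℝ)| / N) := by
  have hNpos : (0 : ℝ) < N := by exact_mod_cast hN
  have := iSup_norm_nonneg α n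
  rw [mul_add, mul_div_cancel₀ _ hNpos.ne']
  nlinarith

/-- **The shift set `H = q·B_α(0,η)` of §12.**  For `N ≥ 1`, `q ≥ 1`, `0 < η ≤ 1`, let
`B = {a ∈ (−N,N) : ν(a) < η}` (as the Bohr predicate) and `H = q·B`.  Then `0 ∈ H`,
`#H ≥ (η/16)^{k+1}N/2` (Lemma 14 (a)), and every `h ∈ H` is `h = qa` with `ν(a) < η` and
`|h| ≤ qηN`. [cite: GreenTao2008QuadraticMobius, Lemma 14 (a) and §12] -/
theorem shiftSet_spec (α : Fin k → ℝ) {N : ℕ} (hN : 1 ≤ N) {q : ℕ} (hq : 1 ≤ q) {η : ℝ}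
    (hη : 0 < η) (hη1 : η ≤ 1) :
    let H := ((Finset.Ioo (-(N : ℤ)) N).filter fun a : ℤ =>
      (∀ i, ‖(((a : ℝ) * α i : ℝ) : AddCircle (1 : ℝ))‖ + |(a : ℝ)| / N < η) ∧ |(a : ℝ)| / N < η).image
        fun a : ℤ => (q : ℤ) * a
    (0 : ℤ) ∈ H ∧ (η / 16) ^ (k + 1) * N / 2 ≤ #H ∧
      ∀ h ∈ H, |(h : ℝ)| ≤ q * η * N ∧ ∃ a : ℤ, h = q * a ∧
        (⨆ i : Fin k, ‖(((a : ℝ) * α i : ℝ) : AddCircle (1 : ℝ))‖) + |(a : ℝ)| / N < η := by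
  intro H
  have hNpos : (0 : ℝ) < N := by exact_mod_cast hN
  set B := (Finset.Ioo (-(N : ℤ)) N).filter fun a : ℤ =>
    (∀ i, ‖(((a : ℝ) * α i : ℝ) : AddCircle (1 : ℝ))‖ + |(a : ℝ)| / N < η) ∧ |(a : ℝ)| / N < η with hB
  have h0B : (0 : ℤ) ∈ B := by
    rw [hB, mem_filter, mem_Ioo]
    refine ⟨⟨by omega, by omega⟩, fun i => ?_, by simp [hη]⟩
    simp [hη]
  refine ⟨mem_image.2 ⟨0, h0B, by simp⟩, ?_, ?_⟩
  · have hcard : #H = #B := card_image_of_injective _ fun a b hab => by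
      have hq0 : (q : ℤ) ≠ 0 := by exact_mod_cast (show q ≠ 0 by omega)
      exact mul_left_cancel₀ hq0 hab
    rw [hcard]
    exact card_rotationBohr_ge k hN α hη hη1
  · intro h hh
    obtain ⟨a, haB, rfl⟩ := mem_image.1 hh
    rw [mem_filter] at haB
    have hgauge : (⨆ i : Fin k, ‖(((a : ℝ) * α i : ℝ) : AddCircle (1 : ℝ))‖) + |(a : ℝ)| / N < η :=
      (bohrGauge_lt_iff α N a η).2 haB.2
    refine ⟨?_, a, rfl, hgauge⟩
    have h1 : |(a : ℝ)| / N < η := haB.2.2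
    rw [div_lt_iff₀ hNpos] at h1
    push_cast
    rw [abs_mul, show |(q : ℝ)| = q from abs_of_nonneg (Nat.cast_nonneg _)]
    have : (0 : ℝ) ≤ q := Nat.cast_nonneg _
    nlinarith

end Summit.Parity.GeneralizedHardyLittlewood.GreenTaoLevelTwoMNTwoBohrGauge
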